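import Literature.Claims.NS.AbuGhuwaleh2026
import HarnessLib

/-!
# C61 `AbuGhuwaleh2026` — kernel records at the composition grain: Theorem 7 AS PRINTED is
content-free as a bound; the constant ledger separates the printed from the consumed reading

Source: M. Abu-Ghuwaleh, «Exact Shell–Bridge Closure and Finite Packet Exhaustion for the Three-Dimensional
Periodic Navier–Stokes Equations», Preprints.org 202603.1889 v1 (2026-03-24, 38 PDF pp.) [cite:
AbuGhuwaleh2026]. Skeleton of record `Literature/Claims/NS/AbuGhuwaleh2026.lean` (p488393, typist-4 g2,
composition grain: `Step_Thm7_printed`, `Step_Thm7_uniform`, `Step_p35_choice`, kernel records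
`choice_of_uniform`, `printed_not_sufficient`). Cell ns-claims (D-0090), refuter-2; referee ref-1 g2;
salvage-p6.

What this file adds to the skeleton's `printed_not_sufficient`:
* `thm7_printed_iff_nonneg` — Theorem 7 in the printed quantifier order («Fix 0 < ε ≪ ρ ≪ δ < 1 and
  K ≥ 4. There exists C_m > 0 such that … κ(K,δ,ε) ≤ C_m(2^{−K} + δ + ε)», PDF p.29–30) is EQUIVALENT to
  the bare nonnegativity of the critical-coefficient ledger: for fixed admissible parameters the factor
  `2^{−K} + δ + ε` is positive, so a constant always exists. As printed, Theorem 7 carries no smallness.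
* `const_one_printed_not_uniform` — the constant ledger `κ ≡ 1` satisfies the printed Theorem 7 and
  violates the UNIFORM reading (one `C_m` for all admissible `(K, δ, ε)`) that the closing choice PDF p.35
  l.23–26 («choose δ and ε sufficiently small, and then choose K sufficiently large, so that
  C_m(2^{−K}+δ+ε)‖u₀‖_{L²} < ν») consumes; so the two readings differ exactly by the (K,δ,ε)-uniformity
  of `C_m`, which no printed sentence supplies (the print's own constants convention §1.7 PDF p.6 and the
  uniformity ledger Remark 5 PDF p.27 list independence of j, N, T only, and dependence on «the finite
  model list Ψ» of Proposition 3, built after «Fix 0 < ε ≪ ρ ≪ δ < 1», PDF p.19).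
* `not_p35_choice_of_const_pos` — a constant positive ledger `κ ≡ c` never meets the p.35 choice
  (hypothesis (30) of Theorem 3) for data of size `a ≥ ν/c`.

WHAT THIS IS NOT: not a claim about NS regularity or blow-up; not a claim about any author beyond the
typed locator.
-/

set_option linter.dupNamespace false

namespace Summit.NavierStokesRegularity.NavierStokesRegularity.Theorems.AbuGhuwaleh2026

open Literature.Claims.NS.AbuGhuwaleh2026

/-- **Theorem 7 as printed is content-free as a bound** (PDF p.29 l.127 – p.30 l.7): with the constant
introduced AFTER the bookkeeping parameters are fixed, the printed bound holds for EVERY nonnegative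
ledger (take `C = κ(K,δ,ε)/(2^{−K}+δ+ε) + 1`). [cite: AbuGhuwaleh2026, Thm 7 PDF p.29–30, (70)–(71)] -/
theorem thm7_printed_iff_nonneg (κ : Ledger) :
    Literature.Claims.NS.AbuGhuwaleh2026.Step_Thm7_printed κ ↔
      ∀ (K : ℕ) (δ ε : ℝ), Admissible K δ ε → 0 ≤ κ K δ ε := by
  constructor
  · intro h K δ ε hadm
    obtain ⟨C, -, h0, -⟩ := h K δ ε hadm
    exact h0
  · intro h K δ ε hadm
    have h0 := h K δ ε hadm
    have hs : 0 < 1 / 2 ^ K + δ + ε := by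
      obtain ⟨hε, hεδ, -, -⟩ := hadm
      have hδ : 0 < δ := hε.trans hεδ
      positivity
    refine ⟨κ K δ ε / (1 / 2 ^ K + δ + ε) + 1,
      add_pos_of_nonneg_of_pos (div_nonneg h0 hs.le) one_pos, h0, ?_⟩
    rw [add_mul, div_mul_cancel₀ _ hs.ne', one_mul]
    exact le_add_of_nonneg_right hs.le

/-- **A constant positive ledger never meets the closing choice p.35 l.23–26** (hypothesis (30) of
Theorem 3) for data of size `a ≥ ν/c`: `κ·a = c·a ≥ ν`. [cite: AbuGhuwaleh2026, PDF p.35 l.23–26; (30) PDF p.14] -/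
theorem not_p35_choice_of_const_pos {c : ℝ} (hc : 0 < c) :
    ¬ Literature.Claims.NS.AbuGhuwaleh2026.Step_p35_choice (fun _ _ _ => c) := by
  intro h
  obtain ⟨K, δ, ε, -, hlt⟩ := h 1 one_pos (1 / c) (by positivity)
  have : c * (1 / c) = 1 := mul_one_div_cancel hc.ne'
  linarith

/-- **The two readings of Theorem 7 differ exactly by the uniformity the print does not state**: the
constant ledger `κ ≡ 1` satisfies Theorem 7 AS PRINTED and violates the UNIFORM reading consumed on
PDF p.35 (else `choice_of_uniform` would place `1·a` below `ν` for `a = ν = 1`).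
[cite: AbuGhuwaleh2026, Thm 7 PDF p.29–30; PDF p.35 l.23–26; §1.7 PDF p.6; Remark 5 PDF p.27] -/
theorem const_one_printed_not_uniform :
    Literature.Claims.NS.AbuGhuwaleh2026.Step_Thm7_printed (fun _ _ _ => 1) ∧
      ¬ Literature.Claims.NS.AbuGhuwaleh2026.Step_Thm7_uniform (fun _ _ _ => 1) := by
  refine ⟨(thm7_printed_iff_nonneg _).mpr fun _ _ _ _ => zero_le_one, fun h => ?_⟩
  exact not_p35_choice_of_const_pos one_pos (choice_of_uniform h)

end Summit.NavierStokesRegularity.NavierStokesRegularity.Theorems.AbuGhuwaleh2026
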